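import Summits.CriticalPhenomena.PercolationContinuityZ3.Theorems.PercShatteringRaceNearLinearTwoClusterDecayOfSparseShellNonCertainty
import Literature.Probability.Percolation.ClusterExplorationDecoupling
import Summits.CriticalPhenomena.PercolationContinuityZ3.Theorems.PercShatteringRaceNearLinearTwoClusterDecayStubExplorationBound
import Summits.CriticalPhenomena.PercolationContinuityZ3.Theorems.PercShatteringRaceNearLinearTwoClusterDecayOfTICM

/-!
# Line `first-cluster-exploration-independent-crossings-meet` — lead skeleton (rev L2) for the crux
# `NearLinearTwoClusterDecay` (stmt-CriticalPhenomena-5785, route `PercShatteringRace`, rank 2)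

Crux (fixed, by name): `PercShatteringRace.NearLinearTwoClusterDecay` = `U(1/6)`:
`P_{p_c(ℤ³)}(A₂(n, ⌈n^{7/6}⌉)) → 0`, `A₂(n,m)` = "the configuration restricted to `Λ(m)` has two
in-box-distinct open clusters each meeting `Λ(n)` and `∂ⁱⁿΛ(m)`".

THE LINE (card `Ideas/first-cluster-exploration-independent-crossings-meet.md`, planner skeleton
`Lines/first_cluster_exploration_independent_crossings_meet.lean`), RESHAPED by the lead
(prover-line-stmt-CriticalPhenomena-5785-1, 2026-08-16) onto the tree's LANDED orange-peeling chain: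

* the planner's `stub_shellProduct` + transfer are no longer stubs: the peel inequality, the shell
  independence, the geometric chain and the transfer at every exponent `α > 1` are the landed theorems
  `real_twoCluster_peel`, `tendsto_of_peelChain`, `nearLinearTwoClusterDecay_of_fixedAspectShellNonCertainty`
  (p85433, p85476, p87166, p90414; `Theorems/PercShatteringRaceNearLinearTwoClusterDecayOf[Sparse]ShellNonCertainty.lean`),
  which this file IMPORTS; accordingly every event is stated in the landed OPEN-SHELL vocabulary
  `Sh(N, R)` := "the configuration restricted to `T = Λ(R) ∖ Λ(N)` has two `T`-distinct open clusters from
  the inner layer `Λ(N+1) ∖ Λ(N)` to `∂ⁱⁿΛ(R)`" (verbatim the hypothesis of the landed theorem);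
* `stub_explorationBound` (the card's LEVER; CLOSED — landed p97134 by worker wave 1 as
  `Theorems.stub_explorationBound`, with the reusable abstract multi-source exploration lemma
  `NearLinearTwoClusterDecayExploration.measure_twoCrossings_le_lintegral`; every `p`, `N`, `R`):
  `P_p(Sh(N,R)) ≤ ∫ P_p(AvoidSection_{N,R}(ω)) dP_p(ω)` where `AvoidSection(ω)` = "for some inner-layer
  point `u` whose `T`-cluster reaches `∂ⁱⁿΛ(R)` in `ω`, the (fresh) configuration `ω'` has a crossing of
  `T` avoiding the vertex set `C_T(ω, u)`" — the first-crossing-cluster exploration is a stopping set of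
  pairs (`ClusterExplorationDecoupling.lean` for one source; here finitely many sources explored in a
  fixed order until the first crossing cluster), a second `T`-distinct crossing cluster lives on the
  unexplored pairs, and `measure_mem_dataEvent_eq_lintegral` turns this into the integral (Fubini-free:
  the integral form IS the product-measure form `(P ⊗ P)(AvoidablePair)` of the planner's skeleton,
  without a measurability side-goal);
* `stub_independentCrossingsMeet` (C⁺ = `∃ M ≥ 2, TICM_M`; OPEN, hardest, the lead's; `d = 3`, `p = p_c`):
  `∃ M ≥ 2, ∃ c > 0, ∀ᶠ N, ∫ P_{p_c}(AvoidSection_{N,MN}(ω)) dP_{p_c}(ω) ≤ 1 - c` — Two Independent critical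
  Crossings of a long shell Meet. The only place where an input false above six dimensions enters.
* `NearLinearTwoClusterDecay_of : Stubs.stub_explorationBound → Stubs.stub_independentCrossingsMeet →
  NearLinearTwoClusterDecay` (hypotheses = the stub `Prop`s BY NAME), PROVED: the two stubs give the clean
  bounded-aspect non-certainty `NP_M` (`nonCertainty_of_ticm`, `ENNReal.toReal` bookkeeping with
  `ε = min c (1/2)`), and the landed `nearLinearTwoClusterDecay_of_fixedAspectShellNonCertainty` concludes
  the crux by name; `critBoxTwoArmsDecay_of`: the same two stubs close the sibling crux
  `PercFiniteBoxLRO.CritBoxTwoArmsDecay` (stmt-CriticalPhenomena-0859).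

Disproof.lean (cdisprove v5, RESISTS; read 2026-08-16T10:20Z) honoured: `not_atExponent_of_le_one` /
`not_tendsto_additive_aspect` / near-miss (e) — the per-shell input is `≤ 1 - c` at ONE bounded
multiplicative aspect and decay comes only from the `≍ log n` skins of the landed chain (exponent `> 1`
used there); `nearLinearTwoClusterDecay_false_without_arms` — every event keeps both arms;
`real_twoClusterEvt_le_sq` / `percolationContinuityZ3_of_crossingDecay` — the `X_B` road (crossing decay)
is NOT a stub here; `TICM_M` is implied by `X_B(M)` but its content is the CONDITIONAL unavoidability.
`-- Targets`: none yet for this line. No stub is an instance of a refuted strengthening.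
-/

noncomputable section

open MeasureTheory Filter Topology
open scoped ENNReal
open Literature.Probability.LatticeModels Literature.Probability.Percolation

namespace Summit.CriticalPhenomena.PercolationContinuityZ3.Cruxes.NearLinearTwoClusterDecay.FirstClusterExplorationIndependentCrossingsMeet

/-! ## The two registered stubs: precise `Prop`s `Stubs.stub_*` + sorried theorems `stub_*` -/

namespace Stubs

/-- **Stub `Prop` A (`ExplorationBound`, the lever; provable now)** — every `p`, `N`, `R`:
`P_p(Sh(N,R)) ≤ ∫ P_p(AvoidSection_{N,R}(ω)) dP_p(ω)`. -/
def stub_explorationBound : Prop :=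
  ∀ (p : unitInterval) (N R : ℕ),
    bondPercolation (zdGraph 3) p
        {ω : BondConfig (Site 3) |
          ∃ u ∈ (↑(box 3 (N + 1)) : Set (Site 3)) \ ↑(box 3 N),
          ∃ u' ∈ (↑(box 3 (N + 1)) : Set (Site 3)) \ ↑(box 3 N),
          ∃ v ∈ innerBoundary (zdGraph 3) (box 3 R),
          ∃ v' ∈ innerBoundary (zdGraph 3) (box 3 R),
            ω ∈ openConnIn ((↑(box 3 R) : Set (Site 3)) \ ↑(box 3 N)) u v ∧
            ω ∈ openConnIn ((↑(box 3 R) : Set (Site 3)) \ ↑(box 3 N)) u' v' ∧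
            ω ∉ openConnIn ((↑(box 3 R) : Set (Site 3)) \ ↑(box 3 N)) u u'} ≤
      ∫⁻ ω, bondPercolation (zdGraph 3) p
        {ω' : BondConfig (Site 3) |
          ∃ u ∈ (↑(box 3 (N + 1)) : Set (Site 3)) \ ↑(box 3 N),
          ∃ v ∈ innerBoundary (zdGraph 3) (box 3 R),
            ω ∈ openConnIn ((↑(box 3 R) : Set (Site 3)) \ ↑(box 3 N)) u v ∧
            ∃ u' ∈ (↑(box 3 (N + 1)) : Set (Site 3)) \ ↑(box 3 N),
            ∃ v' ∈ innerBoundary (zdGraph 3) (box 3 R),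
              ω' ∈ openConnIn ((((↑(box 3 R) : Set (Site 3)) \ ↑(box 3 N))) ∩
                {w : Site 3 | ω ∉ openConnIn ((↑(box 3 R) : Set (Site 3)) \ ↑(box 3 N)) u w}) u' v'}
        ∂(bondPercolation (zdGraph 3) p)

/-- **Stub `Prop` B (`IndependentCrossingsMeet` = `∃ M ≥ 2, TICM_M`; OPEN, hardest; `d = 3`,
`p = p_c(ℤ³)`)** — at one bounded aspect `M`, for all large `N`,
`∫ P_{p_c}(AvoidSection_{N,MN}(ω)) dP_{p_c}(ω) ≤ 1 - c`. -/
def stub_independentCrossingsMeet : Prop :=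
  ∃ M : ℕ, 2 ≤ M ∧ ∃ c : ℝ, 0 < c ∧ ∀ᶠ N : ℕ in atTop,
    ∫⁻ ω, bondPercolation (zdGraph 3) (criticalProbI 3)
        {ω' : BondConfig (Site 3) |
          ∃ u ∈ (↑(box 3 (N + 1)) : Set (Site 3)) \ ↑(box 3 N),
          ∃ v ∈ innerBoundary (zdGraph 3) (box 3 (M * N)),
            ω ∈ openConnIn ((↑(box 3 (M * N)) : Set (Site 3)) \ ↑(box 3 N)) u v ∧
            ∃ u' ∈ (↑(box 3 (N + 1)) : Set (Site 3)) \ ↑(box 3 N),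
            ∃ v' ∈ innerBoundary (zdGraph 3) (box 3 (M * N)),
              ω' ∈ openConnIn ((((↑(box 3 (M * N)) : Set (Site 3)) \ ↑(box 3 N))) ∩
                {w : Site 3 | ω ∉ openConnIn ((↑(box 3 (M * N)) : Set (Site 3)) \ ↑(box 3 N)) u w})
                u' v'}
      ∂(bondPercolation (zdGraph 3) (criticalProbI 3)) ≤ ENNReal.ofReal (1 - c)

end Stubs

/-- **stub A (registered) = `Stubs.stub_explorationBound` spelled out — the FIRST-CLUSTER EXPLORATION
bound (the card's lever; provable now, size M; every `p`, `N`, `R`).**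
`P_p(Sh(N,R)) ≤ ∫ P_p({ω' | ∃ u ∈ Λ(N+1)∖Λ(N), v ∈ ∂ⁱⁿΛ(R), ω ∈ {u ↔ v in T} ∧
  ∃ u', v', ω' ∈ {u' ↔ v' in T ∩ {w | ω ∉ {u ↔ w in T}}}}) dP_p(ω)`, `T = Λ(R) ∖ Λ(N)`.
Proof route: enumerate the inner layer `L = (box 3 (N+1) \ box 3 N).toList`; for `ω` let `C_j(ω)` be the
`T`-cluster of `L[j]` (`{w | ω ∈ openConnIn T L[j] w}`), `j⋆(ω)` the least `j` with `C_j ∩ ∂ⁱⁿΛ(R) ≠ ∅`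
(all of `L` if none), `U(ω) = ⋃_{j ≤ j⋆} C_j(ω)`, `N(ω)` = the pairs of `T.sym2` with an endpoint in
`U(ω)` (= `⋃_{j ≤ j⋆}` of the single-source explored sets of `ClusterExploration.exists_explored`).
(1) `IsStoppingSet N`: agreement on `N ω` gives agreement on each single-source explored set, hence
(`ClusterExploration.isStoppingSet_explored`, `openConnIn_iff_of_agree`, `seen_data_eq`) the same
clusters `C_j`, `j ≤ j⋆`, the same `j⋆`, the same `U`, `N`. (2) On `Sh(N,R)` one of the two distinct
crossing clusters differs from `C_{j⋆}` and from every `C_j`, `j < j⋆` (those miss `∂ⁱⁿΛ(R)`), so it is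
vertex-disjoint from `U(ω)`: its open path runs in `T ∖ U(ω) ⊆ T ∩ {w | ω ∉ {L[j⋆] ↔ w in T}}`.
(3) Data event `A F η` := guard (every pair of `F` touches `W F`, `W F := {w | s(w,w) ∈ F}` recovers
`U`) ∧ `∃ u' v', ω' ∈ openConnIn (T ∖ W F) u' v'`, determined by pairs off `F`
(`ClusterExploration.exists_determinedBy_avoid` pattern, finite union over `u'`); then
`measure_mem_dataEvent_eq_lintegral` and `lintegral_mono` (pointwise `A (N ω) (η ω) ⊆ AvoidSection ω`,
witness `u = L[j⋆]`, `v ∈ C_{j⋆} ∩ ∂ⁱⁿΛ(R)`; when `ω` has no crossing source both sides vanish). -/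
theorem stub_explorationBound :
    ∀ (p : unitInterval) (N R : ℕ),
      bondPercolation (zdGraph 3) p
          {ω : BondConfig (Site 3) |
            ∃ u ∈ (↑(box 3 (N + 1)) : Set (Site 3)) \ ↑(box 3 N),
            ∃ u' ∈ (↑(box 3 (N + 1)) : Set (Site 3)) \ ↑(box 3 N),
            ∃ v ∈ innerBoundary (zdGraph 3) (box 3 R),
            ∃ v' ∈ innerBoundary (zdGraph 3) (box 3 R),
              ω ∈ openConnIn ((↑(box 3 R) : Set (Site 3)) \ ↑(box 3 N)) u v ∧
              ω ∈ openConnIn ((↑(box 3 R) : Set (Site 3)) \ ↑(box 3 N)) u' v' ∧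
              ω ∉ openConnIn ((↑(box 3 R) : Set (Site 3)) \ ↑(box 3 N)) u u'} ≤
        ∫⁻ ω, bondPercolation (zdGraph 3) p
          {ω' : BondConfig (Site 3) |
            ∃ u ∈ (↑(box 3 (N + 1)) : Set (Site 3)) \ ↑(box 3 N),
            ∃ v ∈ innerBoundary (zdGraph 3) (box 3 R),
              ω ∈ openConnIn ((↑(box 3 R) : Set (Site 3)) \ ↑(box 3 N)) u v ∧
              ∃ u' ∈ (↑(box 3 (N + 1)) : Set (Site 3)) \ ↑(box 3 N),
              ∃ v' ∈ innerBoundary (zdGraph 3) (box 3 R),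
                ω' ∈ openConnIn ((((↑(box 3 R) : Set (Site 3)) \ ↑(box 3 N))) ∩
                  {w : Site 3 | ω ∉ openConnIn ((↑(box 3 R) : Set (Site 3)) \ ↑(box 3 N)) u w}) u' v'}
          ∂(bondPercolation (zdGraph 3) p) :=
  -- LANDED (worker wave 1, p97134): `Theorems/PercShatteringRaceNearLinearTwoClusterDecayStubExplorationBound.lean`
  Theorems.stub_explorationBound

/-- **stub B (registered) = `Stubs.stub_independentCrossingsMeet` spelled out — Two Independent critical
Crossings of a long shell Meet (`∃ M ≥ 2, TICM_M`; OPEN, hardest; the only place where `d = 3 < 6`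
enters).** There are a bounded aspect `M ≥ 2` and `c > 0` such that for all large `N`:
`∫ P_{p_c}({ω' | ∃ u ∈ Λ(N+1)∖Λ(N), v ∈ ∂ⁱⁿΛ(MN), ω ∈ {u ↔ v in T} ∧ ∃ u', v',
  ω' ∈ {u' ↔ v' in T ∖ C_T^ω(u)}}) dP_{p_c}(ω) ≤ 1 - c`, `T = Λ(MN) ∖ Λ(N)` — an independent critical
crossing of the long shell cannot avoid a crossing cluster of the other copy with probability bounded
below. Why plausibly true / why it might fail: see the planner skeleton's docstring (numerics: conditional
avoidability `0.71, 0.40, 0.29` at `M = 8, 16, 32`, `r = 4`; rising slowly in `r` at `M = 8`, flat at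
`M = 16`; UNDECIDED as `r → ∞`); FALSE for `d ≥ 7` (barrier `SpanningClustersAboveSix`); implied by
`X_B(M)` (summit-strength, not staffed). Admissible weakenings with the same composition through the
landed sparse/polylog chain: `1 - c ↦ 1 - c/(log N)^σ`, `σ < 1`, or one good scale per window of `L`
`M`-adic scales. -/
theorem stub_independentCrossingsMeet :
    ∃ M : ℕ, 2 ≤ M ∧ ∃ c : ℝ, 0 < c ∧ ∀ᶠ N : ℕ in atTop,
      ∫⁻ ω, bondPercolation (zdGraph 3) (criticalProbI 3)
          {ω' : BondConfig (Site 3) |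
            ∃ u ∈ (↑(box 3 (N + 1)) : Set (Site 3)) \ ↑(box 3 N),
            ∃ v ∈ innerBoundary (zdGraph 3) (box 3 (M * N)),
              ω ∈ openConnIn ((↑(box 3 (M * N)) : Set (Site 3)) \ ↑(box 3 N)) u v ∧
              ∃ u' ∈ (↑(box 3 (N + 1)) : Set (Site 3)) \ ↑(box 3 N),
              ∃ v' ∈ innerBoundary (zdGraph 3) (box 3 (M * N)),
                ω' ∈ openConnIn ((((↑(box 3 (M * N)) : Set (Site 3)) \ ↑(box 3 N))) ∩
                  {w : Site 3 | ω ∉ openConnIn ((↑(box 3 (M * N)) : Set (Site 3)) \ ↑(box 3 N)) u w})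
                  u' v'}
        ∂(bondPercolation (zdGraph 3) (criticalProbI 3)) ≤ ENNReal.ofReal (1 - c) := by
  sorry

/-! ## Vocabulary (reducible abbreviations; the stubs above are these, spelled out) -/

/-- `P_p` on `ℤ³`. -/
abbrev P (p : unitInterval) : Measure (BondConfig (Site 3)) := bondPercolation (zdGraph 3) p

/-- Critical bond percolation `P_{p_c}` on `ℤ³`. -/
abbrev Pc : Measure (BondConfig (Site 3)) := bondPercolation (zdGraph 3) (criticalProbI 3)

/-- The inner layer `Λ(N+1) ∖ Λ(N)` (`= {‖v‖∞ = N+1}`) of the open shell above `Λ(N)`. -/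
abbrev layer (N : ℕ) : Set (Site 3) := (↑(box 3 (N + 1)) : Set (Site 3)) \ ↑(box 3 N)

/-- `sphere R = ∂ⁱⁿΛ(R) = {‖v‖∞ = R}`. -/
abbrev sphere (R : ℕ) : Finset (Site 3) := innerBoundary (zdGraph 3) (box 3 R)

/-- The open shell `T(N,R) = Λ(R) ∖ Λ(N) = {N < ‖v‖∞ ≤ R}` (landed vocabulary). -/
abbrev shell (N R : ℕ) : Set (Site 3) := (↑(box 3 R) : Set (Site 3)) \ ↑(box 3 N)

/-- `Sh(N,R)`: the configuration restricted to `T(N,R)` has two `T`-distinct open clusters each joining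
the inner layer to `∂ⁱⁿΛ(R)` (verbatim the hypothesis event of the landed peel chain). -/
abbrev shellTwoCluster (N R : ℕ) : Set (BondConfig (Site 3)) :=
  {ω | ∃ u ∈ layer N, ∃ u' ∈ layer N, ∃ v ∈ sphere R, ∃ v' ∈ sphere R,
    ω ∈ openConnIn (shell N R) u v ∧ ω ∈ openConnIn (shell N R) u' v' ∧
    ω ∉ openConnIn (shell N R) u u'}

/-- `AvoidSection_{N,R}(ω)`: the configurations `ω'` that cross `T(N,R)` avoiding the vertex set of the
`ω`-`T`-cluster of SOME inner-layer point `u` whose `ω`-`T`-cluster reaches `∂ⁱⁿΛ(R)` (the `ω`-section of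
the planner's `AvoidablePair`). -/
abbrev avoidSection (N R : ℕ) (ω : BondConfig (Site 3)) : Set (BondConfig (Site 3)) :=
  {ω' | ∃ u ∈ layer N, ∃ v ∈ sphere R, ω ∈ openConnIn (shell N R) u v ∧
    ∃ u' ∈ layer N, ∃ v' ∈ sphere R,
      ω' ∈ openConnIn (shell N R ∩ {w : Site 3 | ω ∉ openConnIn (shell N R) u w}) u' v'}

/-- `t_p(N,R) = ∫ P_p(AvoidSection_{N,R}(ω)) dP_p(ω)` (= `(P_p ⊗ P_p)(AvoidablePair N R)` by Tonelli). -/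
abbrev avoidIntegral (p : unitInterval) (N R : ℕ) : ℝ≥0∞ := ∫⁻ ω, P p (avoidSection N R ω) ∂(P p)

/-- `NP_M` (clean bounded-aspect shell non-certainty, the landed chain's input). -/
abbrev NonCertainty (M : ℕ) : Prop :=
  ∃ ε : ℝ, 0 < ε ∧ ∀ᶠ N : ℕ in atTop, Pc.real (shellTwoCluster N (M * N)) ≤ 1 - ε

/-- `TICM_M` (two independent crossings meet, at aspect `M`, integral form). -/
abbrev TICM (M : ℕ) : Prop :=
  ∃ c : ℝ, 0 < c ∧ ∀ᶠ N : ℕ in atTop, avoidIntegral (criticalProbI 3) N (M * N) ≤ ENNReal.ofReal (1 - c)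

/-- Read-back: the crux is literally `P_{p_c}(A₂(n, ⌈n^{7/6}⌉)) → 0`. -/
theorem crux_iff :
    Summit.CriticalPhenomena.PercolationContinuityZ3.Theses.PercShatteringRace.NearLinearTwoClusterDecay ↔
      Tendsto (fun n : ℕ => Pc.real
        {ω | ∃ x ∈ box 3 n, ∃ x' ∈ box 3 n, ∃ y ∈ sphere ⌈(n : ℝ) ^ ((7 : ℝ) / 6)⌉₊,
          ∃ y' ∈ sphere ⌈(n : ℝ) ^ ((7 : ℝ) / 6)⌉₊,
            ω ∈ openConnIn (↑(box 3 ⌈(n : ℝ) ^ ((7 : ℝ) / 6)⌉₊) : Set (Site 3)) x y ∧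
            ω ∈ openConnIn (↑(box 3 ⌈(n : ℝ) ^ ((7 : ℝ) / 6)⌉₊) : Set (Site 3)) x' y' ∧
            ω ∉ openConnIn (↑(box 3 ⌈(n : ℝ) ^ ((7 : ℝ) / 6)⌉₊) : Set (Site 3)) x x'}) atTop (𝓝 0) :=
  Iff.rfl

/-- The stub `Prop`s are the abbreviations spelled out (definitional consistency, `Iff.rfl`). -/
theorem stub_explorationBound_iff :
    Stubs.stub_explorationBound ↔
      ∀ (p : unitInterval) (N R : ℕ), P p (shellTwoCluster N R) ≤ avoidIntegral p N R :=
  Iff.rfl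

theorem stub_independentCrossingsMeet_iff :
    Stubs.stub_independentCrossingsMeet ↔ ∃ M : ℕ, 2 ≤ M ∧ TICM M :=
  Iff.rfl

/-! ## Proved glue: the engine `TICM_M ⇒ NP_M` -/

/-- **The engine** (`TICM_M ⇒ NP_M`, with `ε = min c (1/2)`): the exploration bound at `p = p_c`,
`R = M N`, and `ENNReal.toReal` bookkeeping. -/
theorem nonCertainty_of_ticm
    (hEB : ∀ N R : ℕ, Pc (shellTwoCluster N R) ≤ avoidIntegral (criticalProbI 3) N R)
    {M : ℕ} (hT : TICM M) : NonCertainty M := by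
  obtain ⟨c, hc, hev⟩ := hT
  refine ⟨min c (1 / 2), lt_min hc (by norm_num), ?_⟩
  filter_upwards [hev] with N hN
  have h1 : Pc (shellTwoCluster N (M * N)) ≤ ENNReal.ofReal (1 - c) := (hEB N (M * N)).trans hN
  have h2 : Pc.real (shellTwoCluster N (M * N)) ≤ max (1 - c) 0 := by
    rw [measureReal_def, ← ENNReal.toReal_ofReal']
    exact ENNReal.toReal_mono ENNReal.ofReal_ne_top h1
  refine h2.trans ?_
  rcases le_total c (1 / 2) with h | h
  · rw [min_eq_left h]
    exact max_le le_rfl (by linarith)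
  · rw [min_eq_right h]
    exact max_le (by linarith) (by norm_num)

/-! ## The composition (kernel-checked, no `sorry`) -/

/-- **Composition `NearLinearTwoClusterDecay_of`** — hypotheses = the two stub `Prop`s BY NAME,
conclusion = the crux BY NAME: stubs A + B give `NP_M` (`nonCertainty_of_ticm`), and the landed
`nearLinearTwoClusterDecay_of_fixedAspectShellNonCertainty` (orange-peeling chain, tree) concludes. -/
theorem NearLinearTwoClusterDecay_of (hEB : Stubs.stub_explorationBound)
    (hT : Stubs.stub_independentCrossingsMeet) :
    Summit.CriticalPhenomena.PercolationContinuityZ3.Theses.PercShatteringRace.NearLinearTwoClusterDecay := by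
  rw [stub_explorationBound_iff] at hEB
  rw [stub_independentCrossingsMeet_iff] at hT
  obtain ⟨M, hM, hTM⟩ := hT
  obtain ⟨ε, hε, hev⟩ := nonCertainty_of_ticm (fun N R => hEB (criticalProbI 3) N R) hTM
  exact Theorems.nearLinearTwoClusterDecay_of_fixedAspectShellNonCertainty ⟨M, hM, ε, hε, hev⟩

/-- **The same two stubs close the sibling crux `PercFiniteBoxLRO.CritBoxTwoArmsDecay`
(stmt-CriticalPhenomena-0859, `U(b)` for every `b > 0`).** -/
theorem critBoxTwoArmsDecay_of (hEB : Stubs.stub_explorationBound)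
    (hT : Stubs.stub_independentCrossingsMeet) :
    Summit.CriticalPhenomena.PercolationContinuityZ3.Theses.PercFiniteBoxLRO.CritBoxTwoArmsDecay := by
  rw [stub_explorationBound_iff] at hEB
  rw [stub_independentCrossingsMeet_iff] at hT
  obtain ⟨M, hM, hTM⟩ := hT
  obtain ⟨ε, hε, hev⟩ := nonCertainty_of_ticm (fun N R => hEB (criticalProbI 3) N R) hTM
  exact Theorems.critBoxTwoArmsDecay_of_fixedAspectShellNonCertainty ⟨M, hM, ε, hε, hev⟩

/-- **The skeleton IS the crux proof once the two stubs are discharged** (its only non-standard axiom is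
the `sorryAx` of the stubs). -/
theorem NearLinearTwoClusterDecay_proof :
    Summit.CriticalPhenomena.PercolationContinuityZ3.Theses.PercShatteringRace.NearLinearTwoClusterDecay :=
  NearLinearTwoClusterDecay_of stub_explorationBound stub_independentCrossingsMeet

end Summit.CriticalPhenomena.PercolationContinuityZ3.Cruxes.NearLinearTwoClusterDecay.FirstClusterExplorationIndependentCrossingsMeet

end
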